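import Literature.AnabelianGeometry.SemiGraphs.SgAToProfiniteHom
import Literature.AnabelianGeometry.SemiGraphs.Coverticial
import Literature.AnabelianGeometry.Anabelioids.FiniteEtaleLocalDictionaryStabilizer
import Literature.AnabelianGeometry.Anabelioids.ComponentsOrbits
import HarnessLib

/-!
# [SemiAnbd] Rmk 2.2.1 on the profinite presentation: the constituents of a finite étale covering
# read as stabiliser inclusions (bridge brick L1a, proof-only)

Mochizuki, *Semi-graphs of anabelioids*, Publ. RIMS **42** (2006), Rmk 2.2.1 p. 24: along a finite
étale covering `𝒢' → 𝒢` attached to `G' ∈ B(𝒢)`, "`Π_{v'}`, `Π_{e'}` … are the stabilizers in `Π_𝒢`"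
of the corresponding points; Def. 2.2 (i) p. 23 ("the vertices of `𝔾'` that lie over `v` correspond
to the connected components of `S_v`") (kurims `paper:url-f33ace170ff4`).
[cite: MochizukiSemiAnbd2006, Rem. 2.2.1 p.24]

PROOF-ONLY brick L1a of the (R1) bridge (HOME/staging/L3/L3-t3/R1-BRIDGE-SHAPES.md §2, law L1
«finite étale ⇒ tempered»; interface owner abc-iut-L3-t3), over B2 `SgAToProfiniteHom.lean`
(`HomOver.hVOfPath` / `hVProfinite`) and abc-iut-L6-t17's local dictionary
(`range_pi1Map_eq_stabilizer`, `pi1Map_injective_of_star_comp`, `ComponentsOrbits.lean`):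

* `Anabelioids.stabilizer_map_of_mono` — stabilisers are unchanged along a monomorphism (fibre
  functors send monomorphisms to injections);
* `Anabelioids.exists_range_transport_pi1Map_eq_stabilizer` — for `Q ≅ (S × −) ⋙ α` (a finite
  étale constituent) and any path `β`, the transported `π₁(Q)` is INJECTIVE with image the
  STABILISER of a point of `G(S)`;
* `HomOver.hVOfPath_injective_and_exists_range_eq_stabilizer` /
  `hVOfPath_exists_range_eq_stabilizer_of_mono` (+ edge versions `hEOfPath_…`) — the vertex / edge
  homomorphisms of the profinite reading (B2) of a 1-morphism whose constituent at `w` is finite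
  étale onto the component `P` are injective with image `Stab(x)` for a point `x` of the fibre of
  `P`, i.e. (along `P ↪ S_v`) of a point of the ORBIT of `F_v(S_v)` that `P` cuts out
  (`range_map_arrow_eq_orbit`);
* `HomOver.hVProfinite_injective_and_exists_range_eq_stabilizer` /
  `hEAt_injective_and_exists_range_eq_stabilizer` — packaged for t1's `Hom.IsFiniteEtaleCoveringOf φ A`
  (Def. 2.2 (i)).

This is the vertex/edge-group half of the `IsoOver` (B4) between the profinite reading of a finite
étale covering and the covering graph of `BObj.toCovObj A` (B6); the underlying-semi-graph half and
the branch compatibilities (which need the alignment clauses of `IsFiniteEtaleCoveringGlobal`) remain.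
Nothing of the paper is asserted; no side taken on [IUTchIII] Cor. 3.12.
-/

noncomputable section

namespace Literature.AnabelianGeometry.Anabelioids

open CategoryTheory CategoryTheory.Limits CategoryTheory.PreGaloisCategory

universe u

section General

variable {C : Type u} [Category.{u} C] [GaloisCategory C] {D : Type u} [Category.{u} D]
  [GaloisCategory D]

/-- Stabilisers in `Aut F` are unchanged along a monomorphism `i : P ↪ X` (the fibre functor sends `i`
to an `Aut F`-equivariant injection). [cite: MochizukiSemiAnbd2006, Rem. 2.2.1 p.24] -/
theorem stabilizer_map_of_mono (F : C ⥤ FintypeCat.{u}) [FiberFunctor F] {P X : C} (i : P ⟶ X)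
    [Mono i] (x : F.obj P) :
    MulAction.stabilizer (Aut F) (F.map i x) = MulAction.stabilizer (Aut F) x := by
  ext σ
  rw [MulAction.mem_stabilizer_iff, MulAction.mem_stabilizer_iff, mulAction_def, mulAction_def]
  haveI : Mono (F.map i) := inferInstance
  have hinj : Function.Injective (F.map i) :=
    ConcreteCategory.injective_of_mono_of_preservesPullback (F.map i)
  constructor
  · intro h
    exact hinj ((NatTrans.naturality_apply σ.hom i x).symm.trans h)
  · intro h
    exact (NatTrans.naturality_apply σ.hom i x).trans (by rw [h])

omit [GaloisCategory C] in
/-- A point of the one-point fibre of `α(S = S)`, the terminal object of `C_{/S}` carried to `D`.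
[cite: MochizukiGeoAn2004, Def. 1.2.2(i) p.17] -/
theorem nonempty_fiber_equiv_mkId {S : C} (α : Over S ⥤ D) [α.IsEquivalence]
    (F : D ⥤ FintypeCat.{u}) [FiberFunctor F] : Nonempty (F.obj (α.obj (Over.mk (𝟙 S)))) := by
  have hT : IsTerminal (α.obj (Over.mk (𝟙 S))) := Over.mkIdTerminal.isTerminalObj α _
  haveI := isConnected_terminal (C := D)
  obtain ⟨t₀⟩ := nonempty_fiber_of_isConnected F (⊤_ D)
  exact ⟨F.map (hT.uniqueUpToIso terminalIsTerminal).inv t₀⟩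

/-- **Rmk 2.2.1 for a finite étale constituent, transported to any basepoint**: for
`Q ≅ (S × −) ⋙ α` with `α : C_{/S} ⥲ D` and a path `β : Q ⋙ F ≅ G`, the homomorphism
`Aut F → Aut (Q ⋙ F) ⥲ Aut G` is injective and its image is the stabiliser of a point of `G(S)`.
[cite: MochizukiSemiAnbd2006, Rem. 2.2.1 p.24] -/
theorem exists_range_transport_pi1Map_eq_stabilizer {S : C} (α : Over S ⥤ D) [α.IsEquivalence]
    {Q : C ⥤ D} (e : Q ≅ Over.star S ⋙ α) (F : D ⥤ FintypeCat.{u}) [FiberFunctor F]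
    {G : C ⥤ FintypeCat.{u}} (β : Q ⋙ F ≅ G) :
    Function.Injective ((Aut.autMulEquivOfIso β).toMonoidHom.comp (pi1Map Q F)) ∧
      ∃ x : G.obj S, ((Aut.autMulEquivOfIso β).toMonoidHom.comp (pi1Map Q F)).range =
        MulAction.stabilizer (Aut G) x := by
  obtain ⟨t⟩ := nonempty_fiber_equiv_mkId α F
  exact ⟨(Aut.autMulEquivOfIso β).injective.comp (pi1Map_injective_of_star_comp α e F),
    _, range_pi1Map_eq_stabilizer α e F β t⟩

end General

end Literature.AnabelianGeometry.Anabelioids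

namespace Literature.AnabelianGeometry.SemiGraphs

open CategoryTheory CategoryTheory.Limits CategoryTheory.PreGaloisCategory
open Literature.AnabelianGeometry.Anabelioids

universe u

namespace SemiGraphOfAnabelioids.HomOver

variable {𝒢 ℋ : SemiGraphOfAnabelioids.{u, u, u}} {f : 𝒢.graph ⟶ ℋ.graph} (φ : HomOver 𝒢 ℋ f)

/-- The underlying homomorphism of `hVOfPath` is the library composite
`(Aut.autMulEquivOfIso γ) ∘ π₁(φ_v^*)` (bookkeeping, `rfl`). [cite: MochizukiSemiAnbd2006, Rem. 2.4.2 p.26] -/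
theorem hVOfPath_toMonoidHom (v : 𝒢.graph.Vertex)
    (γ : (φ.φV v).pullback ⋙ 𝒢.fibV v ≅ ℋ.fibV (f.vertexMap v)) :
    (φ.hVOfPath v γ).toMonoidHom =
      (Aut.autMulEquivOfIso γ).toMonoidHom.comp (pi1Map (φ.φV v).pullback (𝒢.fibV v)) :=
  rfl

/-- The same for edges. [cite: MochizukiSemiAnbd2006, Rem. 2.4.2 p.26] -/
theorem hEOfPath_toMonoidHom (e : 𝒢.graph.Edge) (e' : ℋ.graph.Edge) (h : f.edgeMap e = e')
    (γ : (φ.φE e e' h).pullback ⋙ 𝒢.fibE e ≅ ℋ.fibE e') :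
    (φ.hEOfPath e e' h γ).toMonoidHom =
      (Aut.autMulEquivOfIso γ).toMonoidHom.comp (pi1Map (φ.φE e e' h).pullback (𝒢.fibE e)) :=
  rfl

/-- **A finite étale vertex constituent reads as a stabiliser inclusion**: if `φ_w^* ≅ (P × −) ⋙ α`
with `α : (ℋ_{f w})_{/P} ⥲ 𝒢_w` (the local description of Def. 2.2 (i): `𝒢_w` is the component
anabelioid `(ℋ_{f w})_P`), then along ANY path `γ` the homomorphism `Π_{𝒢,w} → Π_{ℋ, f w}` of the
profinite reading is injective with image the stabiliser of a point of `F_{f w}(P)`.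
[cite: MochizukiSemiAnbd2006, Rem. 2.2.1 p.24] -/
theorem hVOfPath_injective_and_exists_range_eq_stabilizer (w : 𝒢.graph.Vertex)
    {P : ℋ.V (f.vertexMap w)} (α : Over P ⥤ 𝒢.V w) [α.IsEquivalence]
    (e : (φ.φV w).pullback ≅ Over.star P ⋙ α)
    (γ : (φ.φV w).pullback ⋙ 𝒢.fibV w ≅ ℋ.fibV (f.vertexMap w)) :
    Function.Injective (φ.hVOfPath w γ) ∧
      ∃ x : (ℋ.fibV (f.vertexMap w)).obj P, (φ.hVOfPath w γ).toMonoidHom.range =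
        MulAction.stabilizer (Aut (ℋ.fibV (f.vertexMap w))) x := by
  obtain ⟨hinj, x, hx⟩ := exists_range_transport_pi1Map_eq_stabilizer α e (𝒢.fibV w) γ
  exact ⟨fun a b hab => hinj hab, x, by rw [hVOfPath_toMonoidHom]; exact hx⟩

/-- The edge analogue. [cite: MochizukiSemiAnbd2006, Rem. 2.2.1 p.24] -/
theorem hEOfPath_injective_and_exists_range_eq_stabilizer (e₀ : 𝒢.graph.Edge) (e' : ℋ.graph.Edge)
    (h : f.edgeMap e₀ = e') {P : ℋ.E e'} (α : Over P ⥤ 𝒢.E e₀) [α.IsEquivalence]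
    (e : (φ.φE e₀ e' h).pullback ≅ Over.star P ⋙ α)
    (γ : (φ.φE e₀ e' h).pullback ⋙ 𝒢.fibE e₀ ≅ ℋ.fibE e') :
    Function.Injective (φ.hEOfPath e₀ e' h γ) ∧
      ∃ x : (ℋ.fibE e').obj P, (φ.hEOfPath e₀ e' h γ).toMonoidHom.range =
        MulAction.stabilizer (Aut (ℋ.fibE e')) x := by
  obtain ⟨hinj, x, hx⟩ := exists_range_transport_pi1Map_eq_stabilizer α e (𝒢.fibE e₀) γ
  exact ⟨fun a b hab => hinj hab, x, by rw [hEOfPath_toMonoidHom]; exact hx⟩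

/-- … and along the monomorphism `P ↪ S` of a SUBOBJECT (e.g. a connected component `P` of `S_v`):
the image is the stabiliser of a point of `F_{f w}(S)` lying in the fibre-image of `P` — for a
connected component, in the corresponding `Π_{f w}`-ORBIT (`range_map_arrow_eq_orbit`).
[cite: MochizukiSemiAnbd2006, Rem. 2.2.1 p.24] -/
theorem hVOfPath_exists_range_eq_stabilizer_of_mono (w : 𝒢.graph.Vertex)
    {P S : ℋ.V (f.vertexMap w)} (i : P ⟶ S) [Mono i] (α : Over P ⥤ 𝒢.V w) [α.IsEquivalence]
    (e : (φ.φV w).pullback ≅ Over.star P ⋙ α)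
    (γ : (φ.φV w).pullback ⋙ 𝒢.fibV w ≅ ℋ.fibV (f.vertexMap w)) :
    ∃ y : (ℋ.fibV (f.vertexMap w)).obj S, y ∈ Set.range ((ℋ.fibV (f.vertexMap w)).map i) ∧
      (φ.hVOfPath w γ).toMonoidHom.range = MulAction.stabilizer (Aut (ℋ.fibV (f.vertexMap w))) y := by
  obtain ⟨-, x, hx⟩ := φ.hVOfPath_injective_and_exists_range_eq_stabilizer w α e γ
  exact ⟨(ℋ.fibV (f.vertexMap w)).map i x, ⟨x, rfl⟩, by rw [hx, stabilizer_map_of_mono]⟩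

/-- The edge analogue along a monomorphism. [cite: MochizukiSemiAnbd2006, Rem. 2.2.1 p.24] -/
theorem hEOfPath_exists_range_eq_stabilizer_of_mono (e₀ : 𝒢.graph.Edge) (e' : ℋ.graph.Edge)
    (h : f.edgeMap e₀ = e') {P S : ℋ.E e'} (i : P ⟶ S) [Mono i] (α : Over P ⥤ 𝒢.E e₀)
    [α.IsEquivalence] (e : (φ.φE e₀ e' h).pullback ≅ Over.star P ⋙ α)
    (γ : (φ.φE e₀ e' h).pullback ⋙ 𝒢.fibE e₀ ≅ ℋ.fibE e') :
    ∃ y : (ℋ.fibE e').obj S, y ∈ Set.range ((ℋ.fibE e').map i) ∧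
      (φ.hEOfPath e₀ e' h γ).toMonoidHom.range = MulAction.stabilizer (Aut (ℋ.fibE e')) y := by
  obtain ⟨-, x, hx⟩ := φ.hEOfPath_injective_and_exists_range_eq_stabilizer e₀ e' h α e γ
  exact ⟨(ℋ.fibE e').map i x, ⟨x, rfl⟩, by rw [hx, stabilizer_map_of_mono]⟩

/-- **Packaged for Def. 2.2 (i)**: if `φ` is the finite étale covering attached to `A ∈ B(ℋ)`
(t1's `Hom.IsFiniteEtaleCoveringOf`), then at every vertex `w` the homomorphism
`Π_{𝒢,w} → Π_{ℋ,f w}` of the profinite reading `φ.toProfinite` (B2) is injective, and its image is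
the stabiliser of a point of `F_{f w}(S_{f w})` lying in the orbit cut out by a connected component of
`S_{f w}` ("`Π_{v'}` … the stabilizers", Rmk 2.2.1). [cite: MochizukiSemiAnbd2006, Rem. 2.2.1 p.24] -/
theorem hVProfinite_injective_and_exists_range_eq_stabilizer {A : ℋ.BObj}
    (hφ : φ.toHom.IsFiniteEtaleCoveringOf A) (w : 𝒢.graph.Vertex) :
    Function.Injective (φ.hVProfinite w) ∧
      ∃ (P : π₀Obj (A.S (f.vertexMap w))) (y : (ℋ.fibV (f.vertexMap w)).obj (A.S (f.vertexMap w))),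
        y ∈ MulAction.orbit (Aut (ℋ.fibV (f.vertexMap w))) y ∧
        Set.range ((ℋ.fibV (f.vertexMap w)).map P.1.arrow) =
          MulAction.orbit (Aut (ℋ.fibV (f.vertexMap w))) y ∧
        (φ.hVProfinite w).toMonoidHom.range =
          MulAction.stabilizer (Aut (ℋ.fibV (f.vertexMap w))) y := by
  rcases hφ with ⟨-, cV, cE, -, -, hV, -, -⟩
  change ∀ v', π₀Obj (A.S (f.vertexMap v')) at cV
  obtain ⟨α, hα, hne⟩ := hV w
  obtain ⟨e⟩ := hne
  have hmono : Mono (cV w).1.arrow := inferInstance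
  obtain ⟨hinj, -⟩ :=
    @hVOfPath_injective_and_exists_range_eq_stabilizer _ _ _ φ w _ α hα e (φ.vertexPath w)
  obtain ⟨y, hy, hrange⟩ :=
    @hVOfPath_exists_range_eq_stabilizer_of_mono _ _ _ φ w _ _ (cV w).1.arrow hmono α hα e
      (φ.vertexPath w)
  exact ⟨hinj, cV w, y, MulAction.mem_orbit_self y,
    range_map_arrow_eq_orbit (ℋ.fibV (f.vertexMap w)) (cV w) hy, hrange⟩

/-- The edge analogue of the previous theorem. [cite: MochizukiSemiAnbd2006, Rem. 2.2.1 p.24] -/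
theorem hEAt_injective_and_exists_range_eq_stabilizer {A : ℋ.BObj}
    (hφ : φ.toHom.IsFiniteEtaleCoveringOf A) (e₀ : 𝒢.graph.Edge) :
    Function.Injective (φ.hEAt e₀ (f.edgeMap e₀) rfl) ∧
      ∃ (P : π₀Obj (A.T (f.edgeMap e₀))) (y : (ℋ.fibE (f.edgeMap e₀)).obj (A.T (f.edgeMap e₀))),
        Set.range ((ℋ.fibE (f.edgeMap e₀)).map P.1.arrow) =
          MulAction.orbit (Aut (ℋ.fibE (f.edgeMap e₀))) y ∧
        (φ.hEAt e₀ (f.edgeMap e₀) rfl).toMonoidHom.range =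
          MulAction.stabilizer (Aut (ℋ.fibE (f.edgeMap e₀))) y := by
  rcases hφ with ⟨-, cV, cE, -, -, -, hE, -⟩
  change ∀ e', π₀Obj (A.T (f.edgeMap e')) at cE
  obtain ⟨α, hα, hne⟩ := hE e₀
  obtain ⟨e⟩ := hne
  have hmono : Mono (cE e₀).1.arrow := inferInstance
  obtain ⟨hinj, -⟩ :=
    @hEOfPath_injective_and_exists_range_eq_stabilizer _ _ _ φ e₀ (f.edgeMap e₀) rfl _ α hα e
      (φ.edgePath e₀ (f.edgeMap e₀) rfl)
  obtain ⟨y, hy, hrange⟩ :=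
    @hEOfPath_exists_range_eq_stabilizer_of_mono _ _ _ φ e₀ (f.edgeMap e₀) rfl _ _ (cE e₀).1.arrow
      hmono α hα e (φ.edgePath e₀ (f.edgeMap e₀) rfl)
  exact ⟨hinj, cE e₀, y, range_map_arrow_eq_orbit (ℋ.fibE (f.edgeMap e₀)) (cE e₀) hy, hrange⟩

end SemiGraphOfAnabelioids.HomOver

end Literature.AnabelianGeometry.SemiGraphs

end
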